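import Literature.Analysis.FluidPDE.VorticityCalculus
import Literature.Analysis.FluidPDE.LerayHopfProofs
import Literature.Analysis.FluidPDE.SpaceTimeCalculus
import HarnessLib

/-!
# The vorticity equation for the difference of two classical Navier–Stokes solutions on `ℝ³`

Analysis/FluidPDE support file. It serves the discharge of
`Literature.Analysis.FluidPDE.tao2011_velocity_eq_of_memSobolevX` (Tao 2011, Cor. 4.3 + Thm. 5.4 (iii): two classical
solutions on `[0, T] × ℝ³` in Tao's class `X¹ = L^∞_t H¹_x ∩ L²_t H²_x` with the same datum
coincide), which is carried out in `NSVelocityUniqueness.lean` by the **vorticity energy method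
for the difference** `w = u − v` of two classical solutions `(u, p)`, `(v, q)` of the same forced
system (Majda–Bertozzi, *Vorticity and Incompressible Flow*, §3.2, proof of uniqueness of smooth
solutions via the vorticity formulation; Constantin–Foias, *Navier–Stokes Equations*, Ch. 10).
Taking the curl of the momentum equation kills both pressure gradients, so no hypothesis on the
pressures is ever needed — this is what makes the method fit Tao's statement, in which the
pressure is not normalised.

## Contents (all statements are proved; no new definitions)

* `IsClassicalNSSolutionOn.timeDerivWithin_sub_eq`: the equation for `w = u − v`,
  `∂ₜw = νΔw − ((u·∇)w + (w·∇)v) − ∇(p − q)` (the forcing cancels), in any dimension;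
  `IsClassicalNSSolutionOn.isDivFree_sub`.
* `IsClassicalNSSolutionOn.curl_timeDerivWithin_sub`: its curl,
  `curl ∂ₜw = νΔ(curl w) − curl G`, `G := (u·∇)w + (w·∇)v` (pressure-free; `curl ∇ = 0`,
  `curl Δ = Δ curl`).
* `IsClassicalNSSolutionOn.integral_mul_inner_curl_timeDerivWithin_sub`: the localised enstrophy
  balance (slice identity) against a cut-off `φ ∈ C¹_c`:
  `∫ φ ⟪curl ∂ₜw, ω⟫ = −ν∫ φ |∇ω|² − ν Σᵢ ∫ ∂ᵢφ ⟪∂ᵢω, ω⟫ − ∫ φ ⟪G, curl ω⟫ − ∫ ⟪G, curlCLM(Dφ ⊗ ω)⟫`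
  (`ω = curl w`; Green's identity and the curl integration by parts of `VorticityCalculus.lean`).
* `IsClassicalNSSolutionOn.enstrophy_balance_cutoff_sub`: its time-integrated form on
  `[s, t] ⊆ [0, T]` (fundamental theorem of calculus on time lines, Fubini).
* `IsClassicalNSSolutionOn.enstrophy_cutoff_ineq`, `IsClassicalNSSolutionOn.enstrophy_sub_le`:
  the cut-off is removed (`R → ∞`, dominated convergence), giving, for two solutions with the
  same datum whose difference has bounded enstrophy, finite dissipation `∫₀ᵀ∫|∇ω|² < ∞` and
  transport term `G ∈ L²((0,T) × ℝ³)`, the **enstrophy inequality for the difference**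
  `‖ω(t)‖²_{L²} + 2ν ∫₀ᵗ∫ |∇ω|²_F ≤ 2 ∫₀ᵗ∫ |G| |curl ω|` for every `t ∈ [0, T]`
  (all quantities in `[0, ∞]`).

The template is the tree's `LerayHopfProofs.lean` (cut-off energy identity → time integration →
cut-off removal), with `u` replaced by `ω = curl (u − v)`.

## Mathlib / tree search

Mathlib has no Navier–Stokes theory. Tree (session 2026-08-14): the energy (not enstrophy)
analogue for one solution is `LerayHopfProofs.lean`; the curl calculus used here is
`VorticityCalculus.lean` (`curl_sub`, `curl_const_smul`, `curl_laplacian`,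
`integral_mul_inner_curl_eq`), `VectorCalculus.lean` (`curl_gradient_eq_zero_holds`) and
`WholeSpaceIBP.lean` (`integral_inner_laplacian_add_eq_zero`, the cut-off `cutoff R`); joint
space-time regularity is `ClassicalSolutionCalculus.lean` / `SpaceTimeCalculus.lean` /
`TaoEnstrophyLocalisation.lean` (`IsSmoothSpaceTimeOn.fderiv_slice`). Nothing below exists in the
tree under another name (`lean search 'enstrophy|curl_timeDeriv|vorticity.*sub'`).

## References

* A. J. Majda, A. L. Bertozzi, *Vorticity and Incompressible Flow*, Cambridge Texts in Applied
  Mathematics 27, CUP 2002, §3.2.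
* P. Constantin, C. Foias, *Navier–Stokes Equations*, Chicago Lectures in Mathematics, 1988,
  Ch. 10.
* T. Tao, *Localisation and compactness properties of the Navier–Stokes global regularity
  problem*, Anal. PDE 6 (2013), 25–107, arXiv:1108.1165, Cor. 4.3, Thm. 5.4, Remark 11.3. [Tao2011]
-/

noncomputable section

open MeasureTheory Set Function Filter Topology InnerProductSpace Module
open scoped RealInnerProductSpace ENNReal NNReal Laplacian ContDiff

namespace Literature.Analysis.FluidPDE
section AnyDim

variable {E : Type*} [NormedAddCommGroup E] [InnerProductSpace ℝ E] [FiniteDimensional ℝ E]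
variable {S : Set ℝ} {ν : ℝ} {f u v : ℝ → E → E} {p q : ℝ → E → ℝ}

/-- `∇(θ₁ − θ₂) = ∇θ₁ − ∇θ₂` at a point of differentiability of both. [folklore] -/
theorem gradient_sub' {θ₁ θ₂ : E → ℝ} {x : E} (h₁ : DifferentiableAt ℝ θ₁ x)
    (h₂ : DifferentiableAt ℝ θ₂ x) :
    gradient (θ₁ - θ₂) x = gradient θ₁ x - gradient θ₂ x := by
  haveI : CompleteSpace E := FiniteDimensional.complete ℝ E
  simp only [gradient, fderiv_sub h₁ h₂, map_sub]

omit [FiniteDimensional ℝ E] in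
/-- The one-sided time derivative of a difference of jointly smooth fields is the difference of
the time derivatives. [folklore] -/
theorem IsSmoothSpaceTimeOn.timeDerivWithin_sub {w₁ w₂ : ℝ → E → E} (h₁ : IsSmoothSpaceTimeOn S w₁)
    (h₂ : IsSmoothSpaceTimeOn S w₂) {t : ℝ} (ht : t ∈ S) (x : E) :
    FluidPDE.timeDerivWithin S (w₁ - w₂) t x =
      FluidPDE.timeDerivWithin S w₁ t x - FluidPDE.timeDerivWithin S w₂ t x := by
  simp only [FluidPDE.timeDerivWithin_apply, Pi.sub_apply]
  exact derivWithin_sub (h₁.differentiableWithinAt_time ht x) (h₂.differentiableWithinAt_time ht x)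

/-- **The equation for the difference of two classical solutions** of the same forced system
(any dimension): `∂ₜ(u − v) = νΔ(u − v) − ((u·∇)(u − v) + ((u − v)·∇)v) − ∇(p − q)`; the
forcing cancels and `(u·∇)u − (v·∇)v = (u·∇)w + (w·∇)v`, `w = u − v` (Majda–Bertozzi, §3.2,
proof of uniqueness). [folklore] -/
theorem IsClassicalNSSolutionOn.timeDerivWithin_sub_eq (hu : IsClassicalNSSolutionOn S ν f u p)
    (hv : IsClassicalNSSolutionOn S ν f v q) {t : ℝ} (ht : t ∈ S) (x : E) :
    timeDerivWithin S (u - v) t x =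
      ν • (Δ ((u - v) t)) x
        - (convect (u t) ((u - v) t) x + convect ((u - v) t) (v t) x)
        - gradient ((p - q) t) x := by
  have hu2 : ContDiff ℝ 2 (u t) := (hu.contDiff_velocity ht).of_le (by norm_cast)
  have hv2 : ContDiff ℝ 2 (v t) := (hv.contDiff_velocity ht).of_le (by norm_cast)
  have hp1 : ContDiff ℝ 1 (p t) := (hu.contDiff_pressure ht).of_le (by norm_cast)
  have hq1 : ContDiff ℝ 1 (q t) := (hv.contDiff_pressure ht).of_le (by norm_cast)
  have e1 := hu.momentum t ht x
  have e2 := hv.momentum t ht x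
  rw [hu.smooth_velocity.timeDerivWithin_sub hv.smooth_velocity ht x]
  have hΔ : (Δ ((u - v) t)) x = (Δ (u t)) x - (Δ (v t)) x := by
    rw [Pi.sub_apply]
    exact hu2.contDiffAt.laplacian_sub hv2.contDiffAt
  have hgrad : gradient ((p - q) t) x = gradient (p t) x - gradient (q t) x := by
    rw [Pi.sub_apply]
    exact gradient_sub' (hp1.differentiable one_ne_zero x) (hq1.differentiable one_ne_zero x)
  have hconv : convect (u t) ((u - v) t) x + convect ((u - v) t) (v t) x =
      convect (u t) (u t) x - convect (v t) (v t) x := by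
    simp only [convect, Pi.sub_apply]
    rw [fderiv_sub (hu2.differentiable (by norm_num) x) (hv2.differentiable (by norm_num) x)]
    simp only [sub_apply, map_sub]
    abel
  rw [hΔ, hgrad, hconv]
  have e1' : timeDerivWithin S u t x =
      ν • (Δ (u t)) x - gradient (p t) x + f t x - convect (u t) (u t) x := by
    rw [← e1]; abel
  have e2' : timeDerivWithin S v t x =
      ν • (Δ (v t)) x - gradient (q t) x + f t x - convect (v t) (v t) x := by
    rw [← e2]; abel
  rw [e1', e2', smul_sub]
  abel

/-- The difference of two classical solutions is divergence free. [folklore] -/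
theorem IsClassicalNSSolutionOn.isDivFree_sub (hu : IsClassicalNSSolutionOn S ν f u p)
    (hv : IsClassicalNSSolutionOn S ν f v q) {t : ℝ} (ht : t ∈ S) : VectorCalculus.IsDivFree ((u - v) t) := by
  intro x
  have hu1 : ContDiff ℝ 1 (u t) := (hu.contDiff_velocity ht).of_le (by norm_cast)
  have hv1 : ContDiff ℝ 1 (v t) := (hv.contDiff_velocity ht).of_le (by norm_cast)
  simp only [VectorCalculus.divergence, Pi.sub_apply]
  rw [fderiv_sub (hu1.differentiable one_ne_zero x) (hv1.differentiable one_ne_zero x)]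
  have := hu.divFree t ht x
  have := hv.divFree t ht x
  simp only [VectorCalculus.divergence] at *
  simp [map_sub, *]

end AnyDim

section R3


variable {S : Set ℝ} {ν : ℝ} {f u v : ℝ → EuclideanSpace ℝ (Fin 3) → EuclideanSpace ℝ (Fin 3)}
  {p q : ℝ → EuclideanSpace ℝ (Fin 3) → ℝ}

/-- **The curl of the equation for the difference is pressure-free** (`ℝ³`): with `w = u − v`
and `G = (u·∇)w + (w·∇)v`, `curl ∂ₜw = νΔ(curl w) − curl G` on `S × ℝ³` (`curl ∇(p − q) = 0`
by `curl_gradient_eq_zero_holds`, `curl Δ = Δ curl` by `curl_laplacian`; Majda–Bertozzi, §3.2,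
the vorticity equation). [folklore] -/
theorem IsClassicalNSSolutionOn.curl_timeDerivWithin_sub (hu : IsClassicalNSSolutionOn S ν f u p)
    (hv : IsClassicalNSSolutionOn S ν f v q) (hS : UniqueDiffOn ℝ S) {t : ℝ} (ht : t ∈ S)
    (x : EuclideanSpace ℝ (Fin 3)) :
    curl (timeDerivWithin S (u - v) t) x =
      ν • (Δ (curl ((u - v) t))) x
        - curl (fun y => convect (u t) ((u - v) t) y + convect ((u - v) t) (v t) y) x := by
  have hw : IsSmoothSpaceTimeOn S (u - v) := hu.smooth_velocity.sub hv.smooth_velocity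
  have hπ : IsSmoothSpaceTimeOn S (p - q) := hu.smooth_pressure.sub hv.smooth_pressure
  have hwt3 : ContDiff ℝ 3 ((u - v) t) := (hw.contDiff_slice ht).of_le (by norm_cast)
  have hΔ : ContDiff ℝ ∞ fun y => (Δ ((u - v) t)) y := (hw.laplacian hS).contDiff_slice ht
  have hG : ContDiff ℝ ∞ fun y => convect (u t) ((u - v) t) y + convect ((u - v) t) (v t) y :=
    ((hu.smooth_velocity.convect hw hS).add (hw.convect hv.smooth_velocity hS)).contDiff_slice ht
  have hgrad : ContDiff ℝ ∞ fun y => gradient ((p - q) t) y := (hπ.gradient hS).contDiff_slice ht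
  have hπ2 : ContDiff ℝ 2 ((p - q) t) := (hπ.contDiff_slice ht).of_le (by norm_cast)
  have dΔ : DifferentiableAt ℝ (fun y => ν • (Δ ((u - v) t)) y) x :=
    ((hΔ.differentiable (by simp)) x).const_smul ν
  have dG :
      DifferentiableAt ℝ (fun y => convect (u t) ((u - v) t) y + convect ((u - v) t) (v t) y) x :=
    (hG.differentiable (by simp)) x
  have dgrad : DifferentiableAt ℝ (fun y => gradient ((p - q) t) y) x :=
    (hgrad.differentiable (by simp)) x
  -- the equation, as an identity of slice functions
  have hEq : timeDerivWithin S (u - v) t = fun y =>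
      (ν • (Δ ((u - v) t)) y - (convect (u t) ((u - v) t) y + convect ((u - v) t) (v t) y))
        - gradient ((p - q) t) y :=
    funext fun y => hu.timeDerivWithin_sub_eq hv ht y
  have h1 : curl (timeDerivWithin S (u - v) t) x =
      curl (fun y => ν • (Δ ((u - v) t)) y
        - (convect (u t) ((u - v) t) y + convect ((u - v) t) (v t) y)) x
        - curl (fun y => gradient ((p - q) t) y) x := by
    rw [hEq]
    exact curl_sub (dΔ.sub dG) dgrad
  have h2 : curl (fun y => gradient ((p - q) t) y) x = 0 :=
    curl_gradient_eq_zero_holds _ hπ2 x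
  have h3 : curl (fun y => ν • (Δ ((u - v) t)) y
      - (convect (u t) ((u - v) t) y + convect ((u - v) t) (v t) y)) x =
      ν • curl (Δ ((u - v) t)) x
        - curl (fun y => convect (u t) ((u - v) t) y + convect ((u - v) t) (v t) y) x := by
    rw [curl_sub dΔ dG, curl_const_smul ((hΔ.differentiable (by simp)) x) ν]
  rw [h1, h2, sub_zero, h3, curl_laplacian hwt3 x]

/-- **The localised enstrophy balance for the difference of two classical solutions** (slice
identity): for `φ ∈ C¹_c(ℝ³)`, `ω = curl (u − v)`, `G = (u·∇)(u − v) + ((u − v)·∇)v`,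
`∫ φ ⟪curl ∂ₜ(u − v), ω⟫ = −ν ∫ φ |∇ω|²_F − ν Σᵢ ∫ ∂ᵢφ ⟪∂ᵢω, ω⟫ − ∫ φ ⟪G, curl ω⟫`
`  − ∫ ⟪G, curlCLM (Dφ ⊗ ω)⟫`
(pair `curl_timeDerivWithin_sub` with `φ ω`; Green's identity
`integral_inner_laplacian_add_eq_zero` for the viscous term and the curl integration by parts
`integral_mul_inner_curl_eq` for the transport term). [folklore] -/
theorem IsClassicalNSSolutionOn.integral_mul_inner_curl_timeDerivWithin_sub
    (hu : IsClassicalNSSolutionOn S ν f u p) (hv : IsClassicalNSSolutionOn S ν f v q)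
    (hS : UniqueDiffOn ℝ S) {t : ℝ} (ht : t ∈ S) {φ : EuclideanSpace ℝ (Fin 3) → ℝ}
    (hφ : ContDiff ℝ 1 φ)
    (hc : HasCompactSupport φ) :
    ∫ x, φ x * ⟪curl (timeDerivWithin S (u - v) t) x, curl ((u - v) t) x⟫ =
      -(ν * ∫ x, φ x * frobeniusNormSq (fderiv ℝ (curl ((u - v) t)) x))
      - ν * (∫ x, ∑ i, fderiv ℝ φ x (stdOrthonormalBasis ℝ (EuclideanSpace ℝ (Fin 3)) i) *
          ⟪fderiv ℝ (curl ((u - v) t)) x (stdOrthonormalBasis ℝ (EuclideanSpace ℝ (Fin 3)) i),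
            curl ((u - v) t) x⟫)
      - (∫ x, φ x * ⟪convect (u t) ((u - v) t) x + convect ((u - v) t) (v t) x,
          curl (curl ((u - v) t)) x⟫)
      - ∫ x, ⟪convect (u t) ((u - v) t) x + convect ((u - v) t) (v t) x,
          curlCLM ((fderiv ℝ φ x).smulRight (curl ((u - v) t) x))⟫ := by
  set b := stdOrthonormalBasis ℝ (EuclideanSpace ℝ (Fin 3))
  set W : EuclideanSpace ℝ (Fin 3) → EuclideanSpace ℝ (Fin 3) := curl ((u - v) t) with hWdef
  set G := fun y => convect (u t) ((u - v) t) y + convect ((u - v) t) (v t) y with hGdef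
  have hw : IsSmoothSpaceTimeOn S (u - v) := hu.smooth_velocity.sub hv.smooth_velocity
  have hwt : ContDiff ℝ ∞ ((u - v) t) := hw.contDiff_slice ht
  have hW2 : ContDiff ℝ 2 W := contDiff_curl (n := 2) (hwt.of_le (by norm_cast))
  have hW1 : ContDiff ℝ 1 W := hW2.of_le one_le_two
  have hG1 : ContDiff ℝ 1 G :=
    (((hu.smooth_velocity.convect hw hS).add (hw.convect hv.smooth_velocity hS)).contDiff_slice
      ht).of_le (by norm_cast)
  have hΨ1 : ContDiff ℝ 1 fun y => φ y • W y := hφ.smul hW1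
  have hΨc : HasCompactSupport fun y => φ y • W y := hc.smul_right
  have hφc : Continuous φ := hφ.continuous
  have hDφc : Continuous (fderiv ℝ φ) := hφ.continuous_fderiv one_ne_zero
  have hcDφ : HasCompactSupport (fderiv ℝ φ) := hc.fderiv (𝕜 := ℝ)
  have hWc : Continuous W := hW1.continuous
  have hDWc : Continuous (fderiv ℝ W) := hW1.continuous_fderiv one_ne_zero
  have hGc : Continuous G := hG1.continuous
  -- integrability of products with `φ`, `Dφ`
  have cs_φ : ∀ {g : EuclideanSpace ℝ (Fin 3) → ℝ}, Continuous g →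
      Integrable (fun x => φ x * g x) volume :=
    fun hg => (hφc.mul hg).integrable_of_hasCompactSupport hc.mul_right
  have cs_Dφ : ∀ {g : EuclideanSpace ℝ (Fin 3) → ℝ} (z : _ → EuclideanSpace ℝ (Fin 3)),
      Continuous g → Continuous z →
      Integrable (fun x => fderiv ℝ φ x (z x) * g x) volume := fun z hg hz =>
    ((hDφc.clm_apply hz).mul hg).integrable_of_hasCompactSupport
      ((hcDφ.mono fun x hx => by contrapose! hx; simp_all).mul_right)
  -- (i) the curl of the equation, paired with `φ W`
  have hpt : ∀ x, φ x * ⟪curl (timeDerivWithin S (u - v) t) x, W x⟫ =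
      ν * (φ x * ⟪(Δ W) x, W x⟫) - φ x * ⟪curl G x, W x⟫ := fun x => by
    rw [hu.curl_timeDerivWithin_sub hv hS ht x, inner_sub_left, real_inner_smul_left]
    ring
  have iΔ : Integrable (fun x => φ x * ⟪(Δ W) x, W x⟫) volume :=
    cs_φ ((continuous_laplacian hW2).inner hWc)
  have iC : Integrable (fun x => φ x * ⟪curl G x, W x⟫) volume :=
    cs_φ ((continuous_curl hG1).inner hWc)
  -- (ii) the viscous term (Green's identity against `φ W`)
  have eL : ∫ x, φ x * ⟪(Δ W) x, W x⟫ = -(∫ x, φ x * frobeniusNormSq (fderiv ℝ W x)) -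
      ∫ x, ∑ i, fderiv ℝ φ x (b i) * ⟪fderiv ℝ W x (b i), W x⟫ := by
    have h0 := integral_inner_laplacian_add_eq_zero b hW2 hΨ1 (Or.inr hΨc)
    have hDΨ : ∀ x e, fderiv ℝ (fun y => φ y • W y) x e =
        φ x • fderiv ℝ W x e + (fderiv ℝ φ x e) • W x := fun x e => by
      simp [fderiv_fun_smul (hφ.differentiable one_ne_zero x) (hW1.differentiable one_ne_zero x)]
    have iA : ∀ i, Integrable (fun x => φ x * ‖fderiv ℝ W x (b i)‖ ^ 2) volume :=
      fun i => cs_φ ((hDWc.clm_apply continuous_const).norm.pow 2)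
    have iB : ∀ i, Integrable (fun x => fderiv ℝ φ x (b i) * ⟪fderiv ℝ W x (b i), W x⟫)
        (volume : Measure (EuclideanSpace ℝ (Fin 3))) := fun i =>
      cs_Dφ _ ((hDWc.clm_apply continuous_const).inner hWc) continuous_const
    have h1 : ∀ i, ∫ x, ⟪fderiv ℝ W x (b i), fderiv ℝ (fun y => φ y • W y) x (b i)⟫ =
        (∫ x, φ x * ‖fderiv ℝ W x (b i)‖ ^ 2) +
          ∫ x, fderiv ℝ φ x (b i) * ⟪fderiv ℝ W x (b i), W x⟫ := fun i => by
      rw [← integral_add (iA i) (iB i)]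
      refine integral_congr_ae (Eventually.of_forall fun x => ?_)
      simp only [hDΨ, inner_add_right, real_inner_smul_right, real_inner_self_eq_norm_sq]
    have h2 : ∑ i, ∫ x, φ x * ‖fderiv ℝ W x (b i)‖ ^ 2 =
        ∫ x, φ x * frobeniusNormSq (fderiv ℝ W x) := by
      rw [← integral_finsetSum _ fun i _ => iA i]
      refine integral_congr_ae (Eventually.of_forall fun x => ?_)
      simp only [frobeniusNormSq_eq_sum b, Finset.mul_sum]
    have h3 : ∑ i, ∫ x, fderiv ℝ φ x (b i) * ⟪fderiv ℝ W x (b i), W x⟫ =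
        ∫ x, ∑ i, fderiv ℝ φ x (b i) * ⟪fderiv ℝ W x (b i), W x⟫ :=
      (integral_finsetSum _ fun i _ => iB i).symm
    have hA : ∫ x, ⟪(Δ W) x, φ x • W x⟫ = ∫ x, φ x * ⟪(Δ W) x, W x⟫ :=
      integral_congr_ae (Eventually.of_forall fun x => by simp only [real_inner_smul_right])
    simp_rw [h1] at h0
    rw [Finset.sum_add_distrib, h2, h3, hA] at h0
    linarith
  -- (iii) the transport terms (curl integration by parts)
  have eC : ∫ x, φ x * ⟪curl G x, W x⟫ = (∫ x, φ x * ⟪G x, curl W x⟫) +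
      ∫ x, ⟪G x, curlCLM ((fderiv ℝ φ x).smulRight (W x))⟫ :=
    integral_mul_inner_curl_eq hG1 hW1 hφ hc
  -- assemble
  rw [integral_congr_ae (Eventually.of_forall hpt), integral_sub (iΔ.const_mul ν) iC,
    integral_const_mul, eL, eC]
  ring


section TimeIntegration

variable {T ν : ℝ} {f u v : ℝ → EuclideanSpace ℝ (Fin 3) → EuclideanSpace ℝ (Fin 3)}
  {p q : ℝ → EuclideanSpace ℝ (Fin 3) → ℝ}

/-- **Time integration of the localised enstrophy balance, left-hand side**: for continuous
compactly supported `φ` and `0 ≤ s ≤ t ≤ T`,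
`∫ₛᵗ ∫ φ ⟪curl ∂ₜ(u − v), curl (u − v)⟫ = ½∫ φ |curl (u − v)(t)|² − ½∫ φ |curl (u − v)(s)|²`
(`curl ∂ₜ = ∂ₜ curl` for the jointly smooth difference, `SpaceTimeCalculus.lean`; fundamental
theorem of calculus on each time line; Fubini for the jointly continuous, compactly
`x`-supported integrand). [folklore] -/
theorem IsClassicalNSSolutionOn.integral_Ioo_integral_mul_inner_curl_timeDerivWithin_sub
    (hu : IsClassicalNSSolutionOn (Icc 0 T) ν f u p)
    (hv : IsClassicalNSSolutionOn (Icc 0 T) ν f v q) (hT : 0 < T) {φ : EuclideanSpace ℝ (Fin 3) → ℝ}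
    (hφ : Continuous φ) (hc : HasCompactSupport φ) {s t : ℝ} (hs : 0 ≤ s) (hst : s ≤ t)
    (ht : t ≤ T) :
    ∫ τ in Ioo s t, ∫ x, φ x * ⟪curl (timeDerivWithin (Icc 0 T) (u - v) τ) x, curl ((u - v) τ) x⟫ =
      2⁻¹ * (∫ x, φ x * ‖curl ((u - v) t) x‖ ^ 2)
        - 2⁻¹ * (∫ x, φ x * ‖curl ((u - v) s) x‖ ^ 2) := by
  have hU : UniqueDiffOn ℝ (Icc 0 T) := uniqueDiffOn_Icc hT
  have hw : IsSmoothSpaceTimeOn (Icc 0 T) (u - v) := hu.smooth_velocity.sub hv.smooth_velocity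
  set W := fun τ x => curl ((u - v) τ) x with hWdef
  set W' := fun τ x => curl (timeDerivWithin (Icc 0 T) (u - v) τ) x with hW'def
  have hWs : IsSmoothSpaceTimeOn (Icc 0 T) W := (hw.fderiv_slice hU).clm curlCLM
  have hW's : IsSmoothSpaceTimeOn (Icc 0 T) W' :=
    ((hw.timeDerivWithin hU).fderiv_slice hU).clm curlCLM
  have hW_cont : ContinuousOn (uncurry W) (Icc 0 T ×ˢ univ) := hWs.continuousOn
  have hW'_cont : ContinuousOn (uncurry W') (Icc 0 T ×ˢ univ) := hW's.continuousOn
  have hsub : Icc s t ×ˢ (univ : Set (EuclideanSpace ℝ (Fin 3))) ⊆ Icc 0 T ×ˢ univ :=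
    prod_mono (Icc_subset_Icc hs ht) Subset.rfl
  have hKφ : ∀ x ∉ tsupport φ, φ x = 0 := fun x hx => image_eq_zero_of_notMem_tsupport hx
  -- the integrand and its integrability on `(s, t) × ℝ³`
  set D : ℝ × EuclideanSpace ℝ (Fin 3) → ℝ := fun z => φ z.2 * ⟪W' z.1 z.2, W z.1 z.2⟫
    with hD
  have hDcont : ContinuousOn D (Icc s t ×ˢ univ) :=
    (hφ.comp continuous_snd).continuousOn.mul ((hW'_cont.mono hsub).inner (hW_cont.mono hsub))
  have hDK : ∀ τ ∈ Icc s t, ∀ x ∉ tsupport φ, D (τ, x) = 0 := fun τ _ x hx => by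
    simp [hD, hKφ x hx]
  have hDint := integrable_prod_of_continuousOn hc hDcont hDK
  have hswap := integral_integral_swap (f := fun τ x => D (τ, x)) hDint
  simp only [hD] at hswap
  change ∫ τ in Ioo s t, ∫ x, φ x * ⟪W' τ x, W τ x⟫ =
    2⁻¹ * (∫ x, φ x * ‖W t x‖ ^ 2) - 2⁻¹ * (∫ x, φ x * ‖W s x‖ ^ 2)
  rw [hswap]
  -- integrability of the two slices
  have hslice : ∀ {r : ℝ}, r ∈ Icc 0 T →
      Integrable (fun x => φ x * ‖W r x‖ ^ 2) volume := fun hr =>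
    (hφ.mul ((hWs.contDiff_slice hr).continuous.norm.pow 2)).integrable_of_hasCompactSupport
      hc.mul_right
  have htI : t ∈ Icc 0 T := ⟨hs.trans hst, ht⟩
  have hsI : s ∈ Icc 0 T := ⟨hs, hst.trans ht⟩
  -- the fundamental theorem of calculus on each time line
  have hline : ∀ x, ∫ τ in Ioo s t, φ x * ⟪W' τ x, W τ x⟫ =
      2⁻¹ * (φ x * ‖W t x‖ ^ 2) - 2⁻¹ * (φ x * ‖W s x‖ ^ 2) := by
    intro x
    rcases eq_or_lt_of_le hst with rfl | hst'
    · simp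
    have hcont : ContinuousOn (fun τ => 2⁻¹ * (φ x * ‖W τ x‖ ^ 2)) (Icc s t) := by
      refine continuousOn_const.mul (continuousOn_const.mul (ContinuousOn.pow ?_ 2))
      exact (hW_cont.comp (Continuous.prodMk_left x).continuousOn
        fun τ hτ => mk_mem_prod (Icc_subset_Icc hs ht hτ) (mem_univ x)).norm
    have hderiv : ∀ τ ∈ Ioo s t, HasDerivWithinAt (fun τ => 2⁻¹ * (φ x * ‖W τ x‖ ^ 2))
        (φ x * ⟪W' τ x, W τ x⟫) (Ioi τ) τ := by
      intro τ hτ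
      have hτ0 : τ ∈ Ioo 0 T := ⟨hs.trans_lt hτ.1, hτ.2.trans_le ht⟩
      have hW'τ : HasDerivAt (fun σ => W σ x) (W' τ x) τ := by
        have h1 := hw.hasDerivAt_fderiv_slice_timeDerivWithin isOpen_Ioo Ioo_subset_Icc_self
          hτ0 x
        exact curlCLM.hasFDerivAt.comp_hasDerivAt τ h1
      have h2 := ((hW'τ.inner ℝ hW'τ).const_mul (2⁻¹ * φ x)).hasDerivWithinAt (s := Ioi τ)
      have hfun : (fun σ => 2⁻¹ * φ x * ⟪W σ x, W σ x⟫) =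
          fun σ => 2⁻¹ * (φ x * ‖W σ x‖ ^ 2) := by
        funext σ
        rw [real_inner_self_eq_norm_sq]
        ring
      rw [hfun] at h2
      refine h2.congr_deriv ?_
      rw [real_inner_comm]
      ring
    have hint : IntervalIntegrable (fun τ => φ x * ⟪W' τ x, W τ x⟫) volume s t := by
      refine ContinuousOn.intervalIntegrable ?_
      rw [uIcc_of_le hst]
      exact hDcont.comp (Continuous.prodMk_left x).continuousOn
        fun τ hτ => mk_mem_prod hτ (mem_univ x)
    have := intervalIntegral.integral_eq_sub_of_hasDeriv_right_of_le hst hcont hderiv hint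
    rw [intervalIntegral.integral_of_le hst, integral_Ioc_eq_integral_Ioo] at this
    rw [this]
  rw [integral_congr_ae (Eventually.of_forall hline), integral_sub ((hslice htI).const_mul _)
    ((hslice hsI).const_mul _), integral_const_mul, integral_const_mul]

/-- **Time integration of the localised enstrophy balance**: the slice identity
`integral_mul_inner_curl_timeDerivWithin_sub` integrated over `(s, t) ⊆ [0, T]` for a cut-off
`φ ∈ C¹_c`, the left side evaluated by
`integral_Ioo_integral_mul_inner_curl_timeDerivWithin_sub` (all four space-time integrands are
jointly continuous with compact `x`-support, hence integrable on `(s, t) × ℝ³`). [folklore] -/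
theorem IsClassicalNSSolutionOn.enstrophy_balance_cutoff_sub
    (hu : IsClassicalNSSolutionOn (Icc 0 T) ν f u p)
    (hv : IsClassicalNSSolutionOn (Icc 0 T) ν f v q) (hT : 0 < T) {φ : EuclideanSpace ℝ (Fin 3) → ℝ}
    (hφ : ContDiff ℝ 1 φ) (hc : HasCompactSupport φ) {s t : ℝ} (hs : 0 ≤ s) (hst : s ≤ t)
    (ht : t ≤ T) :
    2⁻¹ * (∫ x, φ x * ‖curl ((u - v) t) x‖ ^ 2)
        - 2⁻¹ * (∫ x, φ x * ‖curl ((u - v) s) x‖ ^ 2) =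
      -(ν * ∫ τ in Ioo s t, ∫ x, φ x * frobeniusNormSq (fderiv ℝ (curl ((u - v) τ)) x))
      - ν * (∫ τ in Ioo s t, ∫ x,
          ∑ i, fderiv ℝ φ x (stdOrthonormalBasis ℝ (EuclideanSpace ℝ (Fin 3)) i) *
            ⟪fderiv ℝ (curl ((u - v) τ)) x (stdOrthonormalBasis ℝ (EuclideanSpace ℝ (Fin 3)) i),
              curl ((u - v) τ) x⟫)
      - (∫ τ in Ioo s t, ∫ x, φ x * ⟪convect (u τ) ((u - v) τ) x + convect ((u - v) τ) (v τ) x,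
          curl (curl ((u - v) τ)) x⟫)
      - ∫ τ in Ioo s t, ∫ x, ⟪convect (u τ) ((u - v) τ) x + convect ((u - v) τ) (v τ) x,
          curlCLM ((fderiv ℝ φ x).smulRight (curl ((u - v) τ) x))⟫ := by
  set b := stdOrthonormalBasis ℝ (EuclideanSpace ℝ (Fin 3))
  have hU : UniqueDiffOn ℝ (Icc 0 T) := uniqueDiffOn_Icc hT
  have hw : IsSmoothSpaceTimeOn (Icc 0 T) (u - v) := hu.smooth_velocity.sub hv.smooth_velocity
  rw [← hu.integral_Ioo_integral_mul_inner_curl_timeDerivWithin_sub hv hT hφ.continuous hc hs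
    hst ht]
  -- the fields, jointly smooth on the closed slab
  set W := fun τ => curl ((u - v) τ) with hWdef
  set G := fun τ x => convect (u τ) ((u - v) τ) x + convect ((u - v) τ) (v τ) x with hGdef
  have hWs : IsSmoothSpaceTimeOn (Icc 0 T) W := (hw.fderiv_slice hU).clm curlCLM
  have hGs : IsSmoothSpaceTimeOn (Icc 0 T) G :=
    (hu.smooth_velocity.convect hw hU).add (hw.convect hv.smooth_velocity hU)
  -- joint continuity on `[s, t] × ℝ³`
  have hsub : Icc s t ×ˢ (univ : Set (EuclideanSpace ℝ (Fin 3))) ⊆ Icc 0 T ×ˢ univ :=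
    prod_mono (Icc_subset_Icc hs ht) Subset.rfl
  have cW : ContinuousOn (fun z : ℝ × _ => W z.1 z.2) (Icc s t ×ˢ univ) :=
    hWs.continuousOn.mono hsub
  have cDW : ContinuousOn (fun z : ℝ × _ => fderiv ℝ (W z.1) z.2) (Icc s t ×ˢ univ) :=
    (hWs.fderiv_slice hU).continuousOn.mono hsub
  have cCW : ContinuousOn (fun z : ℝ × _ => curl (W z.1) z.2) (Icc s t ×ˢ univ) :=
    ((hWs.fderiv_slice hU).clm curlCLM).continuousOn.mono hsub
  have cG : ContinuousOn (fun z : ℝ × _ => G z.1 z.2) (Icc s t ×ˢ univ) :=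
    hGs.continuousOn.mono hsub
  have cφ : ContinuousOn (fun z : ℝ × _ => φ z.2) (Icc s t ×ˢ univ) :=
    (hφ.continuous.comp continuous_snd).continuousOn
  have cDφ : ContinuousOn (fun z : ℝ × _ => fderiv ℝ φ z.2) (Icc s t ×ˢ univ) :=
    ((hφ.continuous_fderiv one_ne_zero).comp continuous_snd).continuousOn
  have csr : ContinuousOn (fun z : ℝ × _ => curlCLM ((fderiv ℝ φ z.2).smulRight (W z.1 z.2)))
      (Icc s t ×ˢ univ) := by
    refine curlCLM.continuous.comp_continuousOn ?_
    exact ((ContinuousLinearMap.smulRightL ℝ (EuclideanSpace ℝ (Fin 3))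
      (EuclideanSpace ℝ (Fin 3))).continuous₂.comp_continuousOn
      (cDφ.prodMk cW)).congr fun z _ => by simp
  -- everything vanishes for `x` off the support of `φ`
  have hφK : ∀ x ∉ tsupport φ, φ x = 0 := fun x hx => image_eq_zero_of_notMem_tsupport hx
  have hDφK : ∀ x ∉ tsupport φ, fderiv ℝ φ x = 0 := fun x hx => fderiv_of_notMem_tsupport ℝ hx
  -- integrability on `(s, t) × ℝ³` of the four integrands
  have i1 : Integrable (fun z : ℝ × _ => φ z.2 * frobeniusNormSq (fderiv ℝ (W z.1) z.2))
      (((volume : Measure ℝ).restrict (Ioo s t)).prod volume) :=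
    integrable_prod_of_continuousOn hc (cφ.mul (LerayHopfProofs.continuous_frobeniusNormSq.comp_continuousOn cDW))
      fun τ _ x hx => by simp [hφK x hx]
  have i2 : Integrable (fun z : ℝ × _ => ∑ i, fderiv ℝ φ z.2 (b i) *
      ⟪fderiv ℝ (W z.1) z.2 (b i), W z.1 z.2⟫)
      (((volume : Measure ℝ).restrict (Ioo s t)).prod volume) :=
    integrable_prod_of_continuousOn hc (continuousOn_finsetSum _ fun i _ =>
      (cDφ.clm_apply continuousOn_const).mul ((cDW.clm_apply continuousOn_const).inner cW))
      fun τ _ x hx => by simp [hDφK x hx]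
  have i3 : Integrable (fun z : ℝ × _ => φ z.2 * ⟪G z.1 z.2, curl (W z.1) z.2⟫)
      (((volume : Measure ℝ).restrict (Ioo s t)).prod volume) :=
    integrable_prod_of_continuousOn hc (cφ.mul (cG.inner cCW)) fun τ _ x hx => by
      simp [hφK x hx]
  have i4 : Integrable (fun z : ℝ × _ => ⟪G z.1 z.2,
      curlCLM ((fderiv ℝ φ z.2).smulRight (W z.1 z.2))⟫)
      (((volume : Measure ℝ).restrict (Ioo s t)).prod volume) :=
    integrable_prod_of_continuousOn hc (cG.inner csr) fun τ _ x hx => by simp [hDφK x hx]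
  have j1 := i1.integral_prod_left
  have j2 := i2.integral_prod_left
  have j3 := i3.integral_prod_left
  have j4 := i4.integral_prod_left
  simp only at j1 j2 j3 j4
  -- the slice identity for `τ ∈ (s, t)`
  have hslice : ∀ τ ∈ Ioo s t,
      ∫ x, φ x * ⟪curl (timeDerivWithin (Icc 0 T) (u - v) τ) x, W τ x⟫ =
      -(ν * ∫ x, φ x * frobeniusNormSq (fderiv ℝ (W τ) x))
      - ν * (∫ x, ∑ i, fderiv ℝ φ x (b i) * ⟪fderiv ℝ (W τ) x (b i), W τ x⟫)
      - (∫ x, φ x * ⟪G τ x, curl (W τ) x⟫)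
      - ∫ x, ⟪G τ x, curlCLM ((fderiv ℝ φ x).smulRight (W τ x))⟫ := fun τ hτ =>
    hu.integral_mul_inner_curl_timeDerivWithin_sub hv hU ⟨hs.trans hτ.1.le, hτ.2.le.trans ht⟩ hφ hc
  have k1 : Integrable (fun τ => -(ν * ∫ x, φ x * frobeniusNormSq (fderiv ℝ (W τ) x)))
      ((volume : Measure ℝ).restrict (Ioo s t)) := (j1.const_mul ν).neg
  have k2 : Integrable (fun τ => ν * ∫ x, ∑ i, fderiv ℝ φ x (b i) *
      ⟪fderiv ℝ (W τ) x (b i), W τ x⟫) ((volume : Measure ℝ).restrict (Ioo s t)) :=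
    j2.const_mul ν
  have k12 : Integrable (fun τ => -(ν * ∫ x, φ x * frobeniusNormSq (fderiv ℝ (W τ) x))
      - ν * ∫ x, ∑ i, fderiv ℝ φ x (b i) * ⟪fderiv ℝ (W τ) x (b i), W τ x⟫)
      ((volume : Measure ℝ).restrict (Ioo s t)) := k1.sub k2
  have k123 : Integrable (fun τ => -(ν * ∫ x, φ x * frobeniusNormSq (fderiv ℝ (W τ) x))
      - ν * (∫ x, ∑ i, fderiv ℝ φ x (b i) * ⟪fderiv ℝ (W τ) x (b i), W τ x⟫)
      - ∫ x, φ x * ⟪G τ x, curl (W τ) x⟫)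
      ((volume : Measure ℝ).restrict (Ioo s t)) := k12.sub j3
  rw [setIntegral_congr_fun measurableSet_Ioo hslice, integral_sub k123 j4, integral_sub k12 j3,
    integral_sub k1 k2, integral_neg, integral_const_mul, integral_const_mul]

end TimeIntegration

end R3

section R3b

/-! ### Removing the cut-off: the enstrophy inequality for the difference -/

section LimitTools

/-- `a b ≤ a² + b²` in `ℝ≥0∞`. [folklore] -/
theorem ennreal_mul_le_sq_add_sq (a b : ℝ≥0∞) : a * b ≤ a ^ 2 + b ^ 2 := by
  rcases le_total a b with h | h
  · calc a * b ≤ b * b := by gcongr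
      _ = b ^ 2 := (sq b).symm
      _ ≤ a ^ 2 + b ^ 2 := le_add_self
  · calc a * b ≤ a * a := by gcongr
      _ = a ^ 2 := (sq a).symm
      _ ≤ a ^ 2 + b ^ 2 := le_self_add

/-- `‖L‖ₑ² ≤ ofReal |L|²` (operator norm dominated by the Frobenius norm,
`Fluid.sq_opNorm_le_frobeniusNormSq`), with the natural-number power under `∫⁻` (the tree's
`Fluid.enorm_sq_le_ofReal_frobeniusNormSq` in `NSWeakStrongUniquenessProofs.lean` is the same
bound with the real power `‖L‖ₑ ^ (2 : ℝ)`). [folklore] -/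
theorem sq_enorm_le_ofReal_frobeniusNormSq {E' F' : Type*} [NormedAddCommGroup E']
    [InnerProductSpace ℝ E'] [FiniteDimensional ℝ E'] [NormedAddCommGroup F']
    [InnerProductSpace ℝ F'] (L : E' →L[ℝ] F') :
    ‖L‖ₑ ^ 2 ≤ ENNReal.ofReal (frobeniusNormSq L) := by
  rw [← ofReal_norm, ← ENNReal.ofReal_pow (norm_nonneg _)]
  exact ENNReal.ofReal_le_ofReal (sq_opNorm_le_frobeniusNormSq L)

/-- `ofReal (c / (n + 1)) → 0` as `n → ∞`. [folklore] -/
theorem tendsto_ofReal_div_natCast_add_one (c : ℝ) :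
    Tendsto (fun n : ℕ => ENNReal.ofReal (c / ((n : ℝ) + 1))) atTop (𝓝 0) := by
  rw [← ENNReal.ofReal_zero]
  exact ENNReal.tendsto_ofReal
    (tendsto_const_nhds.div_atTop (tendsto_natCast_atTop_atTop.atTop_add tendsto_const_nhds))

/-- **Iterated integrals against pointwise bounds**: if `‖F τ x‖ₑ ≤ c Φ τ x` on `(a, b) × ℝ³` then
`‖∫_(a,b) ∫ F‖ₑ ≤ c ∫⁻_(a,b) ∫⁻ Φ` (no integrability needed on either side). [folklore] -/
theorem enorm_setIntegral_integral_le {F : ℝ → EuclideanSpace ℝ (Fin 3) → ℝ}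
    {Φ : ℝ → EuclideanSpace ℝ (Fin 3) → ℝ≥0∞} {c : ℝ≥0∞}
    {a b : ℝ} (hc : c ≠ ⊤) (h : ∀ τ ∈ Ioo a b, ∀ x, ‖F τ x‖ₑ ≤ c * Φ τ x) :
    ‖∫ τ in Ioo a b, ∫ x, F τ x‖ₑ ≤ c * ∫⁻ τ in Ioo a b, ∫⁻ x, Φ τ x := by
  calc ‖∫ τ in Ioo a b, ∫ x, F τ x‖ₑ ≤ ∫⁻ τ in Ioo a b, ‖∫ x, F τ x‖ₑ :=
        enorm_integral_le_lintegral_enorm _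
    _ ≤ ∫⁻ τ in Ioo a b, ∫⁻ x, c * Φ τ x := by
        refine setLIntegral_mono' measurableSet_Ioo fun τ hτ => ?_
        exact (enorm_integral_le_lintegral_enorm _).trans (lintegral_mono fun x => h τ hτ x)
    _ = c * ∫⁻ τ in Ioo a b, ∫⁻ x, Φ τ x := by
        rw [← lintegral_const_mul' _ _ hc]
        exact lintegral_congr fun τ => lintegral_const_mul' _ _ hc

/-- Pointwise bound for the viscous cut-off error term:
`|Σᵢ ∂ᵢφ ⟪∂ᵢW, W⟫| ≤ 3 ‖Dφ‖ ‖DW‖ |W|` (standard basis of `ℝ³`). [folklore] -/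
theorem norm_sum_fderiv_mul_inner_le (φ : EuclideanSpace ℝ (Fin 3) → ℝ)
    (W : EuclideanSpace ℝ (Fin 3) → EuclideanSpace ℝ (Fin 3)) (x : EuclideanSpace ℝ (Fin 3)) :
    ‖∑ i, fderiv ℝ φ x (stdOrthonormalBasis ℝ (EuclideanSpace ℝ (Fin 3)) i) *
        ⟪fderiv ℝ W x (stdOrthonormalBasis ℝ (EuclideanSpace ℝ (Fin 3)) i), W x⟫‖ ≤
      3 * ‖fderiv ℝ φ x‖ * (‖fderiv ℝ W x‖ * ‖W x‖) := by
  set b := stdOrthonormalBasis ℝ (EuclideanSpace ℝ (Fin 3))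
  have hcard : (Finset.univ : Finset (Fin (finrank ℝ (EuclideanSpace ℝ (Fin 3))))).card = 3 := by
    rw [Finset.card_univ, Fintype.card_fin, finrank_euclideanSpace_fin]
  have hb1 : ∀ i, ‖b i‖ = 1 := fun i => b.orthonormal.norm_eq_one i
  have hterm : ∀ i, ‖fderiv ℝ φ x (b i) * ⟪fderiv ℝ W x (b i), W x⟫‖ ≤
      ‖fderiv ℝ φ x‖ * (‖fderiv ℝ W x‖ * ‖W x‖) := by
    intro i
    rw [norm_mul]
    have h1 : ‖fderiv ℝ φ x (b i)‖ ≤ ‖fderiv ℝ φ x‖ := by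
      simpa [hb1 i] using (fderiv ℝ φ x).le_opNorm (b i)
    have h2 : ‖⟪fderiv ℝ W x (b i), W x⟫‖ ≤ ‖fderiv ℝ W x‖ * ‖W x‖ := by
      refine (norm_inner_le_norm _ _).trans ?_
      gcongr
      simpa [hb1 i] using (fderiv ℝ W x).le_opNorm (b i)
    exact mul_le_mul h1 h2 (norm_nonneg _) (norm_nonneg _)
  calc ‖∑ i, fderiv ℝ φ x (b i) * ⟪fderiv ℝ W x (b i), W x⟫‖
      ≤ ∑ i, ‖fderiv ℝ φ x (b i) * ⟪fderiv ℝ W x (b i), W x⟫‖ := norm_sum_le _ _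
    _ ≤ ∑ _i : Fin (finrank ℝ (EuclideanSpace ℝ (Fin 3))),
          ‖fderiv ℝ φ x‖ * (‖fderiv ℝ W x‖ * ‖W x‖) :=
        Finset.sum_le_sum fun i _ => hterm i
    _ = 3 * ‖fderiv ℝ φ x‖ * (‖fderiv ℝ W x‖ * ‖W x‖) := by
        rw [Finset.sum_const, hcard, nsmul_eq_mul]
        push_cast
        ring

/-- Pointwise bound for the transport cut-off error term:
`|⟪g, curlCLM (ℓ ⊗ a)⟫| ≤ κ ‖ℓ‖ ‖g‖ ‖a‖`, `κ = ‖curlCLM‖`. [folklore] -/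
theorem norm_inner_curlCLM_smulRight_le (g a : EuclideanSpace ℝ (Fin 3))
    (ℓ : EuclideanSpace ℝ (Fin 3) →L[ℝ] ℝ) :
    ‖⟪g, curlCLM (ℓ.smulRight a)⟫‖ ≤ ‖curlCLM‖ * ‖ℓ‖ * (‖g‖ * ‖a‖) := by
  refine (norm_inner_le_norm _ _).trans ?_
  calc ‖g‖ * ‖curlCLM (ℓ.smulRight a)‖ ≤ ‖g‖ * (‖curlCLM‖ * (‖ℓ‖ * ‖a‖)) := by
        gcongr; exact norm_curlCLM_smulRight_le ℓ a
    _ = ‖curlCLM‖ * ‖ℓ‖ * (‖g‖ * ‖a‖) := by ring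

/-- **`ofReal` of an iterated integral of a nonnegative jointly continuous integrand with compact
`x`-support is the iterated lower integral** (Tonelli). [folklore] -/
theorem ofReal_setIntegral_integral_eq {h : ℝ × EuclideanSpace ℝ (Fin 3) → ℝ} {a b : ℝ}
    {K : Set (EuclideanSpace ℝ (Fin 3))} (hK : IsCompact K)
    (hc : ContinuousOn h (Icc a b ×ˢ univ)) (hz : ∀ τ ∈ Icc a b, ∀ x ∉ K, h (τ, x) = 0)
    (hnn : ∀ τ ∈ Icc a b, ∀ x, 0 ≤ h (τ, x)) :
    ENNReal.ofReal (∫ τ in Ioo a b, ∫ x, h (τ, x)) =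
      ∫⁻ τ in Ioo a b, ∫⁻ x, ENNReal.ofReal (h (τ, x)) := by
  have hi := (integrable_prod_of_continuousOn hK hc hz).integral_prod_left
  rw [ofReal_integral_eq_lintegral_ofReal hi]
  · refine setLIntegral_congr_fun measurableSet_Ioo fun τ hτ => ?_
    have hτ' : τ ∈ Icc a b := Ioo_subset_Icc_self hτ
    have hsl : Continuous fun x => h (τ, x) :=
      hc.comp_continuous (Continuous.prodMk_right τ) fun x => mk_mem_prod hτ' (mem_univ x)
    rw [ofReal_integral_eq_lintegral_ofReal]
    · exact hsl.integrable_of_hasCompactSupport (HasCompactSupport.intro hK (hz τ hτ'))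
    · exact Eventually.of_forall fun x => hnn τ hτ' x
  · refine (ae_restrict_iff' measurableSet_Ioo).2 (Eventually.of_forall fun τ hτ => ?_)
    exact integral_nonneg fun x => hnn τ (Ioo_subset_Icc_self hτ) x

end LimitTools

section Limit

variable {T ν : ℝ} {f u v : ℝ → EuclideanSpace ℝ (Fin 3) → EuclideanSpace ℝ (Fin 3)}
  {p q : ℝ → EuclideanSpace ℝ (Fin 3) → ℝ}

/-- **The cut-off enstrophy inequality in `ℝ≥0∞`** (one fixed cut-off `φ = χ_R`): for two classical
solutions with the same datum,
`∫ χ_R |ω(t)|² + 2ν ∫₀ᵗ∫ χ_R |∇ω|² ≤ 2ν (3C/R) J' + 2 ∫₀ᵗ∫ |G| |curl ω| + 2 (κC/R) J`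
where `J = ∫₀ᵀ∫ |G| |ω|`, `J' = ∫₀ᵀ∫ ‖∇ω‖ |ω|`, `C` the gradient constant of the cut-off and
`κ = ‖curlCLM‖` (from `enstrophy_balance_cutoff_sub` on `[0, t]`, `ω(0) = 0`, and the pointwise
bounds of the three right-hand terms). [folklore] -/
theorem IsClassicalNSSolutionOn.enstrophy_cutoff_ineq
    (hu : IsClassicalNSSolutionOn (Icc 0 T) ν f u p)
    (hv : IsClassicalNSSolutionOn (Icc 0 T) ν f v q) (hT : 0 < T) (hν : 0 ≤ ν) (h0 : u 0 = v 0)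
    {C R : ℝ} (hC0 : 0 ≤ C) (hR : 0 < R)
    (hC : ∀ x : EuclideanSpace ℝ (Fin 3), ‖fderiv ℝ (cutoff R) x‖ ≤ C / R)
    {t : ℝ} (ht : t ∈ Icc 0 T) :
    (∫⁻ x, ENNReal.ofReal (cutoff R x) * ‖curl ((u - v) t) x‖ₑ ^ 2) +
        2 * ENNReal.ofReal ν * ∫⁻ τ in Ioo 0 t, ∫⁻ x, ENNReal.ofReal (cutoff R x) *
          ENNReal.ofReal (frobeniusNormSq (fderiv ℝ (curl ((u - v) τ)) x)) ≤
      2 * ENNReal.ofReal ν * (ENNReal.ofReal (3 * C / R) *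
          ∫⁻ τ in Ioo 0 T, ∫⁻ x, ‖fderiv ℝ (curl ((u - v) τ)) x‖ₑ * ‖curl ((u - v) τ) x‖ₑ) +
        2 * (∫⁻ τ in Ioo 0 t, ∫⁻ x, ‖convect (u τ) ((u - v) τ) x + convect ((u - v) τ) (v τ) x‖ₑ *
          ‖curl (curl ((u - v) τ)) x‖ₑ) +
        2 * (ENNReal.ofReal (‖curlCLM‖ * C / R) *
          ∫⁻ τ in Ioo 0 T, ∫⁻ x, ‖convect (u τ) ((u - v) τ) x + convect ((u - v) τ) (v τ) x‖ₑ *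
            ‖curl ((u - v) τ) x‖ₑ) := by
  set b := stdOrthonormalBasis ℝ (EuclideanSpace ℝ (Fin 3)) with hbdef
  set W := fun τ => curl ((u - v) τ) with hWdef
  set G := fun τ x => convect (u τ) ((u - v) τ) x + convect ((u - v) τ) (v τ) x with hGdef
  set φ : EuclideanSpace ℝ (Fin 3) → ℝ := cutoff R with hφdef
  set ν' : ℝ≥0∞ := ENNReal.ofReal ν with hν'
  have htT : t ≤ T := ht.2
  have hU : UniqueDiffOn ℝ (Icc 0 T) := uniqueDiffOn_Icc hT
  have hw : IsSmoothSpaceTimeOn (Icc 0 T) (u - v) := hu.smooth_velocity.sub hv.smooth_velocity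
  have hWs : IsSmoothSpaceTimeOn (Icc 0 T) W := (hw.fderiv_slice hU).clm curlCLM
  have sW : ∀ {τ}, τ ∈ Icc 0 T → Continuous (W τ) := fun hτ => (hWs.contDiff_slice hτ).continuous
  have cDW : ContinuousOn (fun z : ℝ × _ => fderiv ℝ (W z.1) z.2) (Icc 0 T ×ˢ univ) :=
    (hWs.fderiv_slice hU).continuousOn
  have hφ1 : ContDiff ℝ 1 φ := contDiff_cutoff _
  have hφc : HasCompactSupport φ := hasCompactSupport_cutoff hR
  have hφ01 : ∀ x, 0 ≤ φ x ∧ φ x ≤ 1 := fun x => ⟨cutoff_nonneg _ _, cutoff_le_one _ _⟩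
  have hφK : ∀ x ∉ tsupport φ, φ x = 0 := fun x hx => image_eq_zero_of_notMem_tsupport hx
  -- `ω(0) = 0`
  have hW0 : ∀ x, W 0 x = 0 := by
    intro x
    have h00 : (u - v) 0 = 0 := by funext y; simp [h0]
    simp only [hWdef, h00, curl_zero]
  have hbal := hu.enstrophy_balance_cutoff_sub hv hT hφ1 hφc le_rfl ht.1 htT
  -- the real quantities
  set a : ℝ := ∫ x, φ x * ‖W t x‖ ^ 2 with hadef
  set A : ℝ := ∫ τ in Ioo 0 t, ∫ x, φ x * frobeniusNormSq (fderiv ℝ (W τ) x) with hAdef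
  set B : ℝ := ∫ τ in Ioo 0 t, ∫ x, ∑ i, fderiv ℝ φ x (b i) *
    ⟪fderiv ℝ (W τ) x (b i), W τ x⟫ with hBdef
  set Cc : ℝ := ∫ τ in Ioo 0 t, ∫ x, φ x * ⟪G τ x, curl (W τ) x⟫ with hCdef
  set D : ℝ := ∫ τ in Ioo 0 t, ∫ x, ⟪G τ x, curlCLM ((fderiv ℝ φ x).smulRight (W τ x))⟫
    with hDdef
  have ha0 : ∫ x, φ x * ‖W 0 x‖ ^ 2 = 0 := by simp [hW0]
  have hbal' : a + 2 * ν * A = -(2 * ν * B) - 2 * Cc - 2 * D := by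
    have : 2⁻¹ * a - 2⁻¹ * (∫ x, φ x * ‖W 0 x‖ ^ 2) = -(ν * A) - ν * B - Cc - D := hbal
    rw [ha0] at this
    linarith
  have ha_nn : 0 ≤ a := integral_nonneg fun x => mul_nonneg (hφ01 x).1 (sq_nonneg _)
  have hA_nn : 0 ≤ A := setIntegral_nonneg measurableSet_Ioo fun τ _ =>
    integral_nonneg fun x => mul_nonneg (hφ01 x).1 (frobeniusNormSq_nonneg _)
  have hreal : a + 2 * ν * A ≤ 2 * ν * |B| + 2 * |Cc| + 2 * |D| := by
    rw [hbal']
    have h1 : -(2 * ν * B) ≤ 2 * ν * |B| := by nlinarith [neg_abs_le B, hν]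
    linarith [neg_abs_le Cc, neg_abs_le D, le_abs_self Cc, le_abs_self D]
  -- (i) the left-hand side in `ℝ≥0∞`
  have ea : ENNReal.ofReal a = ∫⁻ x, ENNReal.ofReal (φ x) * ‖W t x‖ₑ ^ 2 := by
    rw [hadef, ofReal_integral_eq_lintegral_ofReal]
    · refine lintegral_congr fun x => ?_
      rw [ENNReal.ofReal_mul (hφ01 x).1, ← ofReal_norm, ENNReal.ofReal_pow (norm_nonneg _)]
    · exact (hφ1.continuous.mul ((sW ht).norm.pow 2)).integrable_of_hasCompactSupport
        hφc.mul_right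
    · exact Eventually.of_forall fun x => mul_nonneg (hφ01 x).1 (sq_nonneg _)
  have eA : ENNReal.ofReal A = ∫⁻ τ in Ioo 0 t, ∫⁻ x, ENNReal.ofReal (φ x) *
      ENNReal.ofReal (frobeniusNormSq (fderiv ℝ (W τ) x)) := by
    have := ofReal_setIntegral_integral_eq (h := fun z : ℝ × _ =>
      φ z.2 * frobeniusNormSq (fderiv ℝ (W z.1) z.2)) (a := 0) (b := t) hφc
      (((hφ1.continuous.comp continuous_snd).continuousOn).mul
        (LerayHopfProofs.continuous_frobeniusNormSq.comp_continuousOn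
          (cDW.mono (prod_mono (Icc_subset_Icc le_rfl htT) Subset.rfl))))
      (fun τ _ x hx => by simp [hφK x hx])
      (fun τ _ x => mul_nonneg (hφ01 x).1 (frobeniusNormSq_nonneg _))
    simp only at this
    rw [hAdef, this]
    refine lintegral_congr fun τ => lintegral_congr fun x => ?_
    rw [ENNReal.ofReal_mul (hφ01 x).1]
  have eLHS : ENNReal.ofReal (a + 2 * ν * A) =
      (∫⁻ x, ENNReal.ofReal (φ x) * ‖W t x‖ₑ ^ 2) +
        2 * ν' * ∫⁻ τ in Ioo 0 t, ∫⁻ x, ENNReal.ofReal (φ x) *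
          ENNReal.ofReal (frobeniusNormSq (fderiv ℝ (W τ) x)) := by
    rw [ENNReal.ofReal_add ha_nn (by positivity), ENNReal.ofReal_mul (by positivity),
      ENNReal.ofReal_mul zero_le_two, ea, eA, hν', ENNReal.ofReal_ofNat]
  -- (ii) the three right-hand terms
  have eC : ‖Cc‖ₑ ≤ 1 * ∫⁻ τ in Ioo 0 t, ∫⁻ x, ‖G τ x‖ₑ * ‖curl (W τ) x‖ₑ := by
    refine enorm_setIntegral_integral_le ENNReal.one_ne_top fun τ _ x => ?_
    rw [one_mul, enorm_mul, Real.enorm_eq_ofReal (hφ01 x).1]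
    calc ENNReal.ofReal (φ x) * ‖⟪G τ x, curl (W τ) x⟫‖ₑ ≤ 1 * (‖G τ x‖ₑ * ‖curl (W τ) x‖ₑ) := by
          gcongr
          · exact ENNReal.ofReal_le_one.2 (hφ01 x).2
          · rw [← ofReal_norm, ← ofReal_norm, ← ofReal_norm, ← ENNReal.ofReal_mul (norm_nonneg _)]
            exact ENNReal.ofReal_le_ofReal (norm_inner_le_norm _ _)
      _ = _ := one_mul _
  have eD : ‖D‖ₑ ≤ ENNReal.ofReal (‖curlCLM‖ * C / R) *
      ∫⁻ τ in Ioo 0 T, ∫⁻ x, ‖G τ x‖ₑ * ‖W τ x‖ₑ := by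
    refine (enorm_setIntegral_integral_le ENNReal.ofReal_ne_top fun τ _ x => ?_).trans
      (mul_le_mul_right (lintegral_mono_set (Ioo_subset_Ioo le_rfl htT)) _)
    rw [← ofReal_norm, ← ofReal_norm, ← ofReal_norm, ← ENNReal.ofReal_mul (norm_nonneg _),
      ← ENNReal.ofReal_mul (by positivity)]
    refine ENNReal.ofReal_le_ofReal ((norm_inner_curlCLM_smulRight_le _ _ _).trans ?_)
    calc ‖curlCLM‖ * ‖fderiv ℝ φ x‖ * (‖G τ x‖ * ‖W τ x‖)
        ≤ ‖curlCLM‖ * (C / R) * (‖G τ x‖ * ‖W τ x‖) := by gcongr; exact hC x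
      _ = ‖curlCLM‖ * C / R * (‖G τ x‖ * ‖W τ x‖) := by ring
  have eB : ‖B‖ₑ ≤ ENNReal.ofReal (3 * C / R) *
      ∫⁻ τ in Ioo 0 T, ∫⁻ x, ‖fderiv ℝ (W τ) x‖ₑ * ‖W τ x‖ₑ := by
    refine (enorm_setIntegral_integral_le ENNReal.ofReal_ne_top fun τ _ x => ?_).trans
      (mul_le_mul_right (lintegral_mono_set (Ioo_subset_Ioo le_rfl htT)) _)
    rw [← ofReal_norm, ← ofReal_norm, ← ofReal_norm, ← ENNReal.ofReal_mul (norm_nonneg _),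
      ← ENNReal.ofReal_mul (by positivity)]
    refine ENNReal.ofReal_le_ofReal ((norm_sum_fderiv_mul_inner_le φ (W τ) x).trans ?_)
    calc 3 * ‖fderiv ℝ φ x‖ * (‖fderiv ℝ (W τ) x‖ * ‖W τ x‖)
        ≤ 3 * (C / R) * (‖fderiv ℝ (W τ) x‖ * ‖W τ x‖) := by gcongr; exact hC x
      _ = 3 * C / R * (‖fderiv ℝ (W τ) x‖ * ‖W τ x‖) := by ring
  -- (iii) combine
  calc (∫⁻ x, ENNReal.ofReal (φ x) * ‖W t x‖ₑ ^ 2) +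
        2 * ν' * ∫⁻ τ in Ioo 0 t, ∫⁻ x, ENNReal.ofReal (φ x) *
          ENNReal.ofReal (frobeniusNormSq (fderiv ℝ (W τ) x))
      = ENNReal.ofReal (a + 2 * ν * A) := eLHS.symm
    _ ≤ ENNReal.ofReal (2 * ν * |B| + 2 * |Cc| + 2 * |D|) := ENNReal.ofReal_le_ofReal hreal
    _ = 2 * ν' * ‖B‖ₑ + 2 * ‖Cc‖ₑ + 2 * ‖D‖ₑ := by
        rw [ENNReal.ofReal_add (by positivity) (by positivity),
          ENNReal.ofReal_add (by positivity) (by positivity),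
          ENNReal.ofReal_mul (by positivity), ENNReal.ofReal_mul (by positivity),
          ENNReal.ofReal_mul (by positivity), ENNReal.ofReal_mul (by positivity),
          ← Real.enorm_eq_ofReal_abs, ← Real.enorm_eq_ofReal_abs, ← Real.enorm_eq_ofReal_abs,
          hν', ENNReal.ofReal_ofNat]
    _ ≤ 2 * ν' * (ENNReal.ofReal (3 * C / R) *
          ∫⁻ τ in Ioo 0 T, ∫⁻ x, ‖fderiv ℝ (W τ) x‖ₑ * ‖W τ x‖ₑ) +
        2 * (∫⁻ τ in Ioo 0 t, ∫⁻ x, ‖G τ x‖ₑ * ‖curl (W τ) x‖ₑ) +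
        2 * (ENNReal.ofReal (‖curlCLM‖ * C / R) * ∫⁻ τ in Ioo 0 T, ∫⁻ x, ‖G τ x‖ₑ * ‖W τ x‖ₑ) := by
        gcongr
        simpa only [one_mul] using eC

/-- **The enstrophy inequality for the difference of two classical solutions** (cut-off removed).
For two classical solutions of the same forced system on `[0, T] × ℝ³` with the same datum, whose
difference `w = u - v` has vorticity `ω = curl w` with `sup_t ‖ω(t)‖₂² ≤ M < ∞`,
`∇ω ∈ L²((0,T) × ℝ³)` and transport term `G = (u·∇)w + (w·∇)v ∈ L²((0,T) × ℝ³)`: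
`‖ω(t)‖₂² + 2ν ∫₀ᵗ ∫ |∇ω|² ≤ 2 ∫₀ᵗ ∫ |G| |curl ω|` for every `t ∈ [0, T]` (all terms in `[0, ∞]`,
Frobenius norm of `∇ω`). Proof: `enstrophy_cutoff_ineq` with `R = n + 1`; the two error terms are
`O(1/R)` since `J, J' < ∞` (from the hypotheses via `ab ≤ a² + b²`), and the left side converges by
dominated convergence (in `x`, and in `τ` for the iterated integral). [folklore] -/
theorem IsClassicalNSSolutionOn.enstrophy_sub_le
    (hu : IsClassicalNSSolutionOn (Icc 0 T) ν f u p)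
    (hv : IsClassicalNSSolutionOn (Icc 0 T) ν f v q) (hT : 0 < T) (hν : 0 ≤ ν) (h0 : u 0 = v 0)
    {M : ℝ≥0∞} (hM : M ≠ ⊤) (hΩM : ∀ τ ∈ Icc 0 T, ∫⁻ x, ‖curl ((u - v) τ) x‖ₑ ^ 2 ≤ M)
    (hPT : ∫⁻ τ in Ioo 0 T, ∫⁻ x,
      ENNReal.ofReal (frobeniusNormSq (fderiv ℝ (curl ((u - v) τ)) x)) < ⊤)
    (hΓT : ∫⁻ τ in Ioo 0 T, ∫⁻ x,
      ‖convect (u τ) ((u - v) τ) x + convect ((u - v) τ) (v τ) x‖ₑ ^ 2 < ⊤)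
    {t : ℝ} (ht : t ∈ Icc 0 T) :
    (∫⁻ x, ‖curl ((u - v) t) x‖ₑ ^ 2) +
        2 * ENNReal.ofReal ν * ∫⁻ τ in Ioo 0 t, ∫⁻ x,
          ENNReal.ofReal (frobeniusNormSq (fderiv ℝ (curl ((u - v) τ)) x)) ≤
      2 * ∫⁻ τ in Ioo 0 t, ∫⁻ x, ‖convect (u τ) ((u - v) τ) x + convect ((u - v) τ) (v τ) x‖ₑ *
        ‖curl (curl ((u - v) τ)) x‖ₑ := by
  set W := fun τ => curl ((u - v) τ) with hWdef
  set G := fun τ x => convect (u τ) ((u - v) τ) x + convect ((u - v) τ) (v τ) x with hGdef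
  set ρ := fun τ x => ENNReal.ofReal (frobeniusNormSq (fderiv ℝ (W τ) x))
    with hρdef
  set I : ℝ≥0∞ := ∫⁻ τ in Ioo 0 t, ∫⁻ x, ‖G τ x‖ₑ * ‖curl (W τ) x‖ₑ with hIdef
  set ν' : ℝ≥0∞ := ENNReal.ofReal ν with hν'
  have htT : t ≤ T := ht.2
  have hU : UniqueDiffOn ℝ (Icc 0 T) := uniqueDiffOn_Icc hT
  have hw : IsSmoothSpaceTimeOn (Icc 0 T) (u - v) := hu.smooth_velocity.sub hv.smooth_velocity
  have hWs : IsSmoothSpaceTimeOn (Icc 0 T) W := (hw.fderiv_slice hU).clm curlCLM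
  have hGs : IsSmoothSpaceTimeOn (Icc 0 T) G :=
    (hu.smooth_velocity.convect hw hU).add (hw.convect hv.smooth_velocity hU)
  -- slices are continuous for `τ ∈ [0, T]`
  have sW : ∀ {τ}, τ ∈ Icc 0 T → Continuous (W τ) := fun hτ => (hWs.contDiff_slice hτ).continuous
  have sDW : ∀ {τ}, τ ∈ Icc 0 T → Continuous (fderiv ℝ (W τ)) := fun hτ =>
    (hWs.contDiff_slice hτ).continuous_fderiv (by simp)
  have sG : ∀ {τ}, τ ∈ Icc 0 T → Continuous (G τ) := fun hτ => (hGs.contDiff_slice hτ).continuous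
  -- product measurability on `(0, T') × ℝ³` for `T' ≤ T`
  have mDW : ∀ {T' : ℝ}, T' ≤ T → AEStronglyMeasurable (fun z : ℝ × _ => fderiv ℝ (W z.1) z.2)
      (((volume : Measure ℝ).restrict (Ioo 0 T')).prod volume) := fun hT' =>
    aestronglyMeasurable_prod_of_continuousOn
      ((hWs.fderiv_slice hU).continuousOn.mono (prod_mono (Icc_subset_Icc le_rfl hT') Subset.rfl))
  have mG : AEStronglyMeasurable (fun z : ℝ × _ => G z.1 z.2)
      (((volume : Measure ℝ).restrict (Ioo 0 T)).prod volume) :=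
    aestronglyMeasurable_prod_of_continuousOn hGs.continuousOn
  have mρ : ∀ {T' : ℝ}, T' ≤ T → AEMeasurable (fun z : ℝ × _ => ρ z.1 z.2)
      (((volume : Measure ℝ).restrict (Ioo 0 T')).prod volume) := fun hT' =>
    ENNReal.measurable_ofReal.comp_aemeasurable
      (LerayHopfProofs.continuous_frobeniusNormSq.comp_aestronglyMeasurable (mDW hT')).aemeasurable
  -- ### finiteness of the auxiliary quantities `J`, `J'`
  set J : ℝ≥0∞ := ∫⁻ τ in Ioo 0 T, ∫⁻ x, ‖G τ x‖ₑ * ‖W τ x‖ₑ with hJdef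
  set J' : ℝ≥0∞ := ∫⁻ τ in Ioo 0 T, ∫⁻ x, ‖fderiv ℝ (W τ) x‖ₑ * ‖W τ x‖ₑ with hJ'def
  have hΩT_lt : ∫⁻ τ in Ioo 0 T, ∫⁻ x, ‖W τ x‖ₑ ^ 2 < ⊤ := by
    calc ∫⁻ τ in Ioo 0 T, ∫⁻ x, ‖W τ x‖ₑ ^ 2 ≤ ∫⁻ _ in Ioo 0 T, M :=
          setLIntegral_mono' measurableSet_Ioo fun τ hτ => hΩM τ (Ioo_subset_Icc_self hτ)
      _ < ⊤ := by
          rw [setLIntegral_const]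
          exact ENNReal.mul_lt_top hM.lt_top (by simp [Real.volume_Ioo])
  have hJ : J < ⊤ := by
    calc J ≤ ∫⁻ τ in Ioo 0 T, (∫⁻ x, ‖G τ x‖ₑ ^ 2) + ∫⁻ x, ‖W τ x‖ₑ ^ 2 := by
          refine setLIntegral_mono' measurableSet_Ioo fun τ hτ => ?_
          have hm : Measurable fun x => ‖G τ x‖ₑ ^ 2 :=
            (continuous_enorm.comp (sG (Ioo_subset_Icc_self hτ))).measurable.pow_const 2
          rw [← lintegral_add_left hm]
          exact lintegral_mono fun x => ennreal_mul_le_sq_add_sq _ _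
      _ = (∫⁻ τ in Ioo 0 T, ∫⁻ x, ‖G τ x‖ₑ ^ 2) + ∫⁻ τ in Ioo 0 T, ∫⁻ x, ‖W τ x‖ₑ ^ 2 :=
          lintegral_add_left' (mG.enorm.pow_const 2).lintegral_prod_right' _
      _ < ⊤ := ENNReal.add_lt_top.2 ⟨hΓT, hΩT_lt⟩
  have hJ' : J' < ⊤ := by
    calc J' ≤ ∫⁻ τ in Ioo 0 T, (∫⁻ x, ρ τ x) + ∫⁻ x, ‖W τ x‖ₑ ^ 2 := by
          refine setLIntegral_mono' measurableSet_Ioo fun τ hτ => ?_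
          have hm : Measurable fun x => ρ τ x := ENNReal.measurable_ofReal.comp
            (LerayHopfProofs.continuous_frobeniusNormSq.comp (sDW (Ioo_subset_Icc_self hτ))).measurable
          rw [← lintegral_add_left hm]
          refine lintegral_mono fun x => (ennreal_mul_le_sq_add_sq _ _).trans ?_
          gcongr
          exact sq_enorm_le_ofReal_frobeniusNormSq _
      _ = (∫⁻ τ in Ioo 0 T, ∫⁻ x, ρ τ x) + ∫⁻ τ in Ioo 0 T, ∫⁻ x, ‖W τ x‖ₑ ^ 2 :=
          lintegral_add_left' (mρ le_rfl).lintegral_prod_right' _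
      _ < ⊤ := ENNReal.add_lt_top.2 ⟨hPT, hΩT_lt⟩
  -- ### Step 1: the cut-off inequality for each `n`
  obtain ⟨C, hC0, hC⟩ := exists_norm_fderiv_cutoff_le (E := (EuclideanSpace ℝ (Fin 3)))
  set χ : ℕ → EuclideanSpace ℝ (Fin 3) → ℝ := fun n => cutoff ((n : ℝ) + 1) with hχdef
  have hRpos : ∀ n : ℕ, (0 : ℝ) < n + 1 := fun n => by positivity
  have hχ01 : ∀ n x, 0 ≤ χ n x ∧ χ n x ≤ 1 := fun n x => ⟨cutoff_nonneg _ _, cutoff_le_one _ _⟩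
  have step1 : ∀ n : ℕ,
      (∫⁻ x, ENNReal.ofReal (χ n x) * ‖W t x‖ₑ ^ 2) +
          2 * ν' * ∫⁻ τ in Ioo 0 t, ∫⁻ x, ENNReal.ofReal (χ n x) * ρ τ x ≤
        2 * ν' * (ENNReal.ofReal (3 * C / ((n : ℝ) + 1)) * J') + 2 * I +
          2 * (ENNReal.ofReal (‖curlCLM‖ * C / ((n : ℝ) + 1)) * J) := fun n =>
    hu.enstrophy_cutoff_ineq hv hT hν h0 hC0 (hRpos n) (hC _ (hRpos n)) ht
  -- ### Step 2: the right-hand sides tend to `2 I`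
  have hRHS : Tendsto (fun n : ℕ => 2 * ν' * (ENNReal.ofReal (3 * C / ((n : ℝ) + 1)) * J') +
      2 * I + 2 * (ENNReal.ofReal (‖curlCLM‖ * C / ((n : ℝ) + 1)) * J)) atTop
      (𝓝 (2 * ν' * (0 * J') + 2 * I + 2 * (0 * J))) := by
    refine ((ENNReal.Tendsto.const_mul ?_ (Or.inr ?_)).add tendsto_const_nhds).add
      (ENNReal.Tendsto.const_mul ?_ (Or.inr ENNReal.ofNat_ne_top))
    · exact ENNReal.Tendsto.mul_const (tendsto_ofReal_div_natCast_add_one _) (Or.inr hJ'.ne)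
    · exact ENNReal.mul_ne_top ENNReal.ofNat_ne_top ENNReal.ofReal_ne_top
    · exact ENNReal.Tendsto.mul_const (tendsto_ofReal_div_natCast_add_one _) (Or.inr hJ.ne)
  simp only [zero_mul, mul_zero, zero_add, add_zero] at hRHS
  -- ### Step 3: the left-hand sides converge (dominated convergence)
  have hlimχ : ∀ x, Tendsto (fun n : ℕ => ENNReal.ofReal (χ n x)) atTop (𝓝 1) := fun x => by
    rw [← ENNReal.ofReal_one]
    exact ENNReal.tendsto_ofReal (tendsto_cutoff_natCast_add_one x)
  have mχ : ∀ n, Measurable fun x => ENNReal.ofReal (χ n x) := fun n =>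
    ENNReal.measurable_ofReal.comp (contDiff_cutoff (n := 1) _).continuous.measurable
  have hLHS1 : Tendsto (fun n : ℕ => ∫⁻ x, ENNReal.ofReal (χ n x) * ‖W t x‖ₑ ^ 2) atTop
      (𝓝 (∫⁻ x, ‖W t x‖ₑ ^ 2)) := by
    refine tendsto_lintegral_of_dominated_convergence' (fun x => ‖W t x‖ₑ ^ 2)
      (fun n => ?_) (fun n => Eventually.of_forall fun x => ?_) ?_
      (Eventually.of_forall fun x => ?_)
    · exact ((mχ n).mul ((continuous_enorm.comp (sW ht)).measurable.pow_const 2)).aemeasurable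
    · calc ENNReal.ofReal (χ n x) * ‖W t x‖ₑ ^ 2 ≤ 1 * ‖W t x‖ₑ ^ 2 := by
            gcongr; exact ENNReal.ofReal_le_one.2 (hχ01 n x).2
        _ = _ := one_mul _
    · exact ((hΩM t ht).trans_lt hM.lt_top).ne
    · simpa using ENNReal.Tendsto.mul_const (hlimχ x) (Or.inr (ENNReal.pow_ne_top enorm_ne_top))
  have hLHS2 : Tendsto (fun n : ℕ => ∫⁻ τ in Ioo 0 t, ∫⁻ x, ENNReal.ofReal (χ n x) * ρ τ x) atTop
      (𝓝 (∫⁻ τ in Ioo 0 t, ∫⁻ x, ρ τ x)) := by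
    have hPt : ∫⁻ τ in Ioo 0 t, ∫⁻ x, ρ τ x < ⊤ :=
      (lintegral_mono_set (Ioo_subset_Ioo le_rfl htT)).trans_lt hPT
    have mΦ : AEMeasurable (fun τ => ∫⁻ x, ρ τ x) ((volume : Measure ℝ).restrict (Ioo 0 t)) :=
      (mρ htT).lintegral_prod_right'
    refine tendsto_lintegral_of_dominated_convergence' (fun τ => ∫⁻ x, ρ τ x)
      (fun n => ?_) (fun n => Eventually.of_forall fun τ => ?_) hPt.ne ?_
    · have : AEMeasurable (fun z : ℝ × _ => ENNReal.ofReal (χ n z.2) * ρ z.1 z.2)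
          (((volume : Measure ℝ).restrict (Ioo 0 t)).prod volume) :=
        ((mχ n).comp measurable_snd).aemeasurable.mul (mρ htT)
      exact this.lintegral_prod_right'
    · refine lintegral_mono fun x => ?_
      calc ENNReal.ofReal (χ n x) * ρ τ x ≤ 1 * ρ τ x := by
            gcongr; exact ENNReal.ofReal_le_one.2 (hχ01 n x).2
        _ = _ := one_mul _
    · -- for a.e. `τ`, the inner integrals converge by dominated convergence in `x`
      have hfin : ∀ᵐ τ ∂((volume : Measure ℝ).restrict (Ioo 0 t)), ∫⁻ x, ρ τ x < ⊤ :=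
        ae_lt_top' mΦ hPt.ne
      have hmem : ∀ᵐ τ ∂((volume : Measure ℝ).restrict (Ioo 0 t)), τ ∈ Ioo 0 t :=
        ae_restrict_mem measurableSet_Ioo
      filter_upwards [hfin, hmem] with τ hτfin hτ
      have hτ' : τ ∈ Icc 0 T := ⟨hτ.1.le, hτ.2.le.trans htT⟩
      refine tendsto_lintegral_of_dominated_convergence' (fun x => ρ τ x)
        (fun n => ?_) (fun n => Eventually.of_forall fun x => ?_) hτfin.ne
        (Eventually.of_forall fun x => ?_)
      · exact ((mχ n).mul (ENNReal.measurable_ofReal.comp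
          (LerayHopfProofs.continuous_frobeniusNormSq.comp (sDW hτ')).measurable)).aemeasurable
      · calc ENNReal.ofReal (χ n x) * ρ τ x ≤ 1 * ρ τ x := by
              gcongr; exact ENNReal.ofReal_le_one.2 (hχ01 n x).2
          _ = _ := one_mul _
      · simpa using ENNReal.Tendsto.mul_const (hlimχ x) (Or.inr ENNReal.ofReal_ne_top)
  have hLHS : Tendsto (fun n : ℕ => (∫⁻ x, ENNReal.ofReal (χ n x) * ‖W t x‖ₑ ^ 2) +
      2 * ν' * ∫⁻ τ in Ioo 0 t, ∫⁻ x, ENNReal.ofReal (χ n x) * ρ τ x) atTop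
      (𝓝 ((∫⁻ x, ‖W t x‖ₑ ^ 2) + 2 * ν' * ∫⁻ τ in Ioo 0 t, ∫⁻ x, ρ τ x)) :=
    hLHS1.add (ENNReal.Tendsto.const_mul hLHS2
      (Or.inr (ENNReal.mul_ne_top ENNReal.ofNat_ne_top ENNReal.ofReal_ne_top)))
  -- ### conclusion
  exact le_of_tendsto_of_tendsto' hLHS hRHS step1

end Limit

end R3b

end Literature.Analysis.FluidPDE

end
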